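import Summits.CriticalPhenomena.CardyFormulaZ2.Theorems.CardySelfRefinementCriticalPathRSWStubRswOfCertificates3Primal
import Summits.CriticalPhenomena.CardyFormulaZ2.Theorems.CardySelfRefinementCriticalPathRSWStubRswOfCertificates3DualA
import Summits.CriticalPhenomena.CardyFormulaZ2.Theorems.CardySelfRefinementCriticalPathRSWStubRswOfCertificates3DualB
import Summits.CriticalPhenomena.CardyFormulaZ2.Theorems.CardySelfRefinementCriticalPathRSWStubRswOfCertificates3SandwichA
import Summits.CriticalPhenomena.CardyFormulaZ2.Theorems.CardySelfRefinementCriticalPathRSWStubRswOfCertificates3SandwichB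

/-!
# From the weak periodic RSW theorem to box-crossing bounds on the certificate set

Item `stmt-CriticalPhenomena-10267` (route `CardySelfRefinement`, crux `CriticalPathRSW`, line
finite-size-envelope): the registered stub `stub_rswOfCertificates3`.

For `k = 2, 3`, a threshold `ε > 0`, a base scale `n₀ ≥ 1` and an aspect ratio `a > 0` there are
`c₀ > 0` and `n₁` such that every self-refinement law `M_k(ρ, c) = selfRefinementMeasure k ρ c`
carrying the two-sided finite-size certificates `M_k(𝓒(kn, 3kn)) ≥ ε` (easy way) and
`M_k(𝓒(3kn, kn)) ≤ 1 - ε` (hard way) at all scales `n ≥ n₀` has the box-crossing bounds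
`BoxCrossingBounds (M_k(ρ, c)) (√2 · ℤ²) a c₀ n₁`, GIVEN the weak periodic Russo–Seymour–Welsh
theorem `KSTPeriodic.WeakPeriodicRSW k t` for `t ≤ k` (Köhler-Schindler–Tassion, Duke Math. J.
172 (2023), Theorem 1 with Comment 1; proved by the KST family of stubs of this line).

Assembly of the support files: `M_k(ρ, c)` is `Admissible k 0` and lattice-carried, the easy
certificate is the short-way hypothesis at offset `0` and the coarse row has finite energy `1/2`,
so `WeakPeriodicRSW k 0` gives primal long crossings (part 1); the dual law
`M_k(ρ, c) ∘ dualConfig⁻¹` is `Admissible k 1`, the hard certificate gives its short-way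
hypothesis by planar duality (part 2a) and bounds the interior density away from `1`, whence its
row finite energy (part 2b), so `WeakPeriodicRSW k 1` gives dual long crossings; the `√2`
sandwich turns primal long crossings into lower bounds (part 3a) and dual long crossings into
upper bounds (part 3b) for the embedded horizontal crossings of `w + [0, a n] × [0, n]`, uniformly
in `w ∈ ℂ` (translations by `kℤ²` absorb the integer part of `w / √2` up to `k`), and vertical
crossings are horizontal crossings of the transposed picture. All constants depend on
`(k, ε, n₀, a)` only.
-/

noncomputable section

namespace Summit.CriticalPhenomena.CardyFormulaZ2.Cruxes.CriticalPathRSW.FiniteSizeEnvelope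

open Set MeasureTheory Filter Topology
open Literature.Probability.LatticeModels Literature.Probability.Percolation

/-- STUB 6 of line `finite-size-envelope` — **from the weak periodic RSW theorem to box-crossing
bounds on the certificate set**: `M_k(ρ,c)` is `Admissible k 0` and lattice-carried, its planar
dual (`Measure.map dualConfig`) is `Admissible k 1`, positively associated and lattice-carried;
the two-sided certificates at all scales `n ≥ n₀` give the short-way hypotheses `𝓒_t(N, 8N) ≥ ε`
(`N = kn`, inclusion of events / planar duality) and the row finite-energy bounds (`p₀ = ½` on a
coarse row for the primal; `min(½, δ₀)` for the dual, `c ≤ 1 - δ₀` being forced by the hard-way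
certificate at scale `n₀`); the weak theorem for primal and dual gives hard-way lower bounds at
every integer aspect ratio, which sandwich the embedded rectangles `w + [0, a n] × [0, n]`
(translations by `kℤ²` + the narrowing lemma `lrRect_subset_lrRect`; the `√2` normalisation of
`squareLatticeEmbedding`). -/
theorem stub_rswOfCertificates3 :
  (∀ k t : ℕ, 1 ≤ k → t ≤ k → KSTPeriodic.WeakPeriodicRSW k t) →
    ∀ k : ℕ, k = 2 ∨ k = 3 → ∀ ε : ℝ, 0 < ε → ∀ n₀ : ℕ, 1 ≤ n₀ → ∀ a : ℝ, 0 < a →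
      ∃ c₀ > 0, ∃ n₁ : ℕ, ∀ ρ c : ℝ,
        (∀ n : ℕ, n₀ ≤ n →
          ε ≤ (selfRefinementMeasure k ρ c).real (KST2023.crossing (k * n) (3 * (k * n))) ∧
            (selfRefinementMeasure k ρ c).real (KST2023.crossing (3 * (k * n)) (k * n)) ≤ 1 - ε) →
          BoxCrossingBounds (selfRefinementMeasure k ρ c) squareLatticeEmbedding.z a c₀ n₁ := by
  have hPrimal := stub_rswOfCertificates3_primal
  have hDualA := stub_rswOfCertificates3_dualA
  have hDualB := stub_rswOfCertificates3_dualB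
  have hSandA := stub_rswOfCertificates3_sandwichA
  have hSandB := stub_rswOfCertificates3_sandwichB
  intro hW k hk ε hε n₀ hn₀ a ha
  have hk2 : 2 ≤ k := by rcases hk with rfl | rfl <;> norm_num
  have hk1 : 1 ≤ k := by omega
  have hk0 : k ≠ 0 := by omega
  -- primal long crossings at the aspect ratio `ρ' = 8 (⌈a⌉ + 1)`
  obtain ⟨c₁, hc₁, N₁, hprim⟩ := hPrimal hW k hk1 ε hε n₀ (8 * (⌈a⌉₊ + 1)) (by omega)
  -- dual long crossings at the aspect ratio `ρ'' = ⌈16 / a⌉`, from `WeakPeriodicRSW k 1`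
  have hρ'' : 1 ≤ ⌈16 / a⌉₊ := Nat.one_le_iff_ne_zero.2 (Nat.ceil_pos.2 (by positivity)).ne'
  have hLpos : (0 : ℝ) < ((6 * (k * n₀) : ℕ) : ℝ) := by
    have : 1 ≤ 6 * (k * n₀) := by
      have : 1 ≤ k * n₀ := Nat.one_le_iff_ne_zero.2 (by positivity)
      omega
    exact_mod_cast this
  set p₀ : ℝ := min (1 / 2) (ε / (2 * ((6 * (k * n₀) : ℕ) : ℝ))) with hp₀
  have hp₀pos : 0 < p₀ := lt_min (by norm_num) (div_pos hε (by linarith))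
  obtain ⟨c₂, hc₂, N₂, hdual⟩ := hW k 1 hk1 (by omega) ε p₀ hε hp₀pos (k * n₀) ⌈16 / a⌉₊ hρ''
  -- the constants
  set T : ℝ := 8 * ((N₁ : ℝ) + k + 2) + 8 * a + 8 * ((N₂ : ℝ) + k + 2) / a + (k + 16 / a) with hT
  refine ⟨min c₁ c₂, lt_min hc₁ hc₂, ⌈T⌉₊, fun ρ c hcert n hn w => ?_⟩
  set μ := selfRefinementMeasure k ρ c with hμdef
  have hTn : T ≤ n := Nat.ceil_le.1 hn
  have hpos1 : 0 ≤ 8 * ((N₁ : ℝ) + k + 2) + 8 * a := by positivity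
  have hpos2 : 0 ≤ 8 * ((N₂ : ℝ) + k + 2) / a := by positivity
  have hpos3 : 0 ≤ (k : ℝ) + 16 / a := by positivity
  have hn1 : 8 * ((N₁ : ℝ) + k + 2) + 8 * a ≤ n := by linarith
  have hn2 : 8 * ((N₂ : ℝ) + k + 2) ≤ a * n := by
    have h : 8 * ((N₂ : ℝ) + k + 2) / a ≤ n := by linarith
    rw [div_le_iff₀ ha] at h
    linarith
  have hn3 : (k : ℝ) + 16 / a ≤ n := by linarith
  -- the standing hypotheses for `μ` and its dual
  obtain ⟨hμ', hshort'⟩ := hDualA k hk0 ρ c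
  have hμ : KSTPeriodic.Admissible k 0 μ :=
    { shift_inv := fun v => selfRefinementMeasure_map_relabel_shift hk0 ρ c v
      transpose_inv := selfRefinementMeasure_map_relabel_transpose k ρ c
      flip_inv := by
        have h : KSTPeriodic.flipEquiv 0 = (reflectIso (0 : Fin 2)).toEquiv := by
          refine Equiv.ext fun x => ?_
          ext j
          fin_cases j <;> simp
        rw [h]
        exact selfRefinementMeasure_map_relabel_reflect hk0 ρ c
      posAssoc := isPositivelyAssociated_selfRefinementMeasure k ρ c }
  have hL : KSTPeriodic.LatticeCarried μ := selfRefinementMeasure_ae_subset_edgeSet k ρ c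
  haveI : IsProbabilityMeasure (μ.map dualConfig) := KSTPeriodic.isProbabilityMeasure_map_dualConfig μ
  -- long crossings of `μ` and of its dual on the certificate set
  have hlong₁ : ∀ N : ℕ, N₁ ≤ N → c₁ ≤ μ.real (KSTPeriodic.crossing 0 (8 * (⌈a⌉₊ + 1) * N) N) :=
    hprim ρ c fun m hm => (hcert m hm).1
  have hq := hDualB.2 k n₀ hk2 hn₀ ε hε ρ c (hcert n₀ le_rfl).2
  have hlong₂ : ∀ N : ℕ, N₂ ≤ N → c₂ ≤ (μ.map dualConfig).real (KSTPeriodic.crossing 1 (⌈16 / a⌉₊ * N) N) :=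
    hdual _ hμ' (KSTPeriodic.latticeCarried_map_dualConfig μ)
      (hshort' n₀ ε fun m hm => (hcert m hm).2)
      ⟨0, fun a' L => hDualB.1 k ρ c p₀ hp₀pos.le (min_le_left _ _)
        ((min_le_right _ _).trans (by linarith)) a' L⟩
  -- the sandwich
  have hlow : ∀ w : ℂ, min c₁ c₂ ≤ μ.real (embRectCrossing (fun v => squareLatticeEmbedding.z v - w) (a * n) n) :=
    fun w => (min_le_left _ _).trans (hSandA k hk1 μ hμ hL a ha c₁ N₁ hlong₁ n hn1 w)
  have hup : ∀ w : ℂ, μ.real (embRectCrossing (fun v => squareLatticeEmbedding.z v - w) (a * n) n) ≤ 1 - min c₁ c₂ :=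
    fun w => (hSandB k hk1 μ hμ hL hμ' a ha c₂ N₂ hlong₂ n hn2 hn3 w).trans
      (by linarith [min_le_right c₁ c₂])
  refine ⟨⟨hlow w, hup w⟩, ?_⟩
  rw [RswCertSandwich.real_embTBCrossing_eq_real_embRectCrossing_of_transpose hμ.transpose_inv]
  exact ⟨hlow _, hup _⟩


end Summit.CriticalPhenomena.CardyFormulaZ2.Cruxes.CriticalPathRSW.FiniteSizeEnvelope

end
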